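import Summits.QuantumFields.BalabanUV.Beta.GAN24.HarmonicPeriodicTwoForm
import Literature.MathematicalPhysics.QuantumFieldTheory.Balaban1983to89.Beta.ResolventComposition

/-!
# `BalabanUV.Beta.GAN24.PeriodicCellPairing` — binder row G-an2-4 ∕ (CONV-C), W-slot CT-W, conservation law (C)∕(C)sym: **PERIODIC CELL PAIRINGS
# (`dz ⊣ codiff₁`, `curv ⊣ curvAdj` ON ONE CELL), THE GAUGE TERM OF THE EULER–LAGRANGE ROW DROPS FOR A DIVERGENCE-FREE FORCE, AND THE RESOLVENT FLUX
# IDENTITY IN PERIODIC FORM: `|box|·(curv A + ½F) = ½·Σ_cell F`** for every block-periodic `A` solving `curvAdj (curv A) = dz g − ½·curvAdj F`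
# (steps (P1) + (ii)–(v) of the route (d′) of this lineage's note `HOME/b2b-balaban-gan24-formalise-leaf-04/g64/CSYM-D3-ANATOMY.md` §8; generic `d`, every
# period `N ≥ 1`; the edge current of `GAN24.WilsonEdgeCurrent` is `−½·curvAdj (p ⊗ q)` — §3)

NOT IN PRINT; OUR BOOKKEEPING ([folklore] discrete exterior calculus on the cubic torus over `AffineAveraging` (`dz ∕ curv ∕ curvAdj ∕ codiff₁ ∕ box ∕ toSite`),
an2's `PeriodicDescent` (`IsPeriodic`) and `ResolventComposition.codiff₁_curvAdj` (`δ ∘ d* = 0`), and the sibling `GAN24.HarmonicPeriodicTwoForm` (`sum_box_shift`,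
`eq_zero_of_periodic_of_box`, `curv_add_eq_const`, `card_mul_const_eq_sum_box`) BY NAME; G-an2-4 formalisation swarm, leaf prover
`b2b-balaban-gan24-formalise-leaf-04`, gen 64).  HONEST FRAMING (cell contract, verbatim): «discharging `BetaPertH` makes Bałaban's UV stability UNCONDITIONAL — a
real constructive-QFT result; it is NOT the continuum limit and NOT the Clay problem.»  HONEST DEPENDENCY (verbatim): «continuum YM on T⁴ ⇐ BetaPertH ∧ nine spine
estimates (0/9 proved); BetaPertH ⇐ (D1) ∧ (D4) ∧ CAP+tail; G-an2-4 gates asym, D1 and NE2/3/4.»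

WHY (the located use, note §3 (d) ∕ §8 (d′)): the cubic × cubic EXCHANGE word of one dressed second-order step is `⟨J′, K·J⟩_cell`, `J = −½·curvAdj F` the edge
current (§3), `K` the `U = 1` KKT resolvent.  With the averaging multiplier `φ = 0` (`GAN24.PeriodicForceMultiplier`) the Euler–Lagrange row of the block-periodic
response reads `curvAdj (curv A) = dz g + J` (`g = codiff₁ (dz μ)` the gauge potential); §4 shows the gauge term drops (`codiff₁ J = 0` ⇒ `codiff₁ (dz g) = 0` ⇒
`dz g = 0` by the gauge energy identity of §1) and then, by the sibling's harmonic-2-form rigidity, `curv A + ½F = ½·avg F` — the flux identity that evaluates the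
exchange to `−(Lc² − 1)·(undressed contact)` once paired by §2.  What remains for a kernel (C_1) at level 0 is the wiring (P2) «the periodic superposition of
`KKTFluctuationKernel.Gam` columns against a bounded periodic force `SolvesKKT`, is periodic, has `φ` = the row of `PeriodicForceMultiplier`» and the bracket
bookkeeping (P4)∕(P5) — NOT here.

WHAT ([folklore]; 0 `def`, 0 cited facts, 0 `def … : Prop`, 0 sorry; generic `d`): §1 `sum_box_dz_mul` (`Σ_cell ⟨dz g, A⟩ = Σ_cell g·codiff₁ A`),
`sum_box_sq_dz_eq_mul_codiff`, **`dz_eq_zero_of_periodic_codiff_dz`**; §2 **`sum_box_curvAdj_mul`** (`Σ_cell ⟨curvAdj F, A⟩ = Σ_cell Σ_{κ,l} F κ l·curv A κ l`, all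
ordered pairs); §3 **`edgeCurrent_eq_neg_half_curvAdj`** (the closed formula of `WilsonEdgeCurrent.sum_box1_biweighted_wilsonA_at` is `−½·curvAdj (p ⊗ q)`);
§4 `curvAdj_add_mul_apply`, **`curvAdj_curv_eq_of_el`**, **`card_mul_curv_add_half_eq`**.  Asserts NO value of Bałaban's tables; discharges NOTHING of (C)sym ∕ (Q-D) ∕
(Q-D-rate) ∕ «T2Shape» ∕ «T2Drift» ∕ (hW, hWall); NEVER «G-an2-4 closed» as (CONV-C); NOT D1, NOT `BetaPertH`, NOT continuum, NOT Clay.  2026-08-22; no existing file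
touched.
-/

noncomputable section

open Finset
open scoped BigOperators
open Literature.MathematicalPhysics.QuantumFieldTheory
open Literature.MathematicalPhysics.QuantumFieldTheory.Balaban1983to89.Beta
open AffineAveraging (Form0 Form1 Form2 unitVec dz curv curvAdj box toSite)
open PeriodicDescent (IsPeriodic)

namespace Summit.QuantumFields.BalabanUV.Beta.GAN24.PeriodicCellPairing

open AffineAveraging (codiff₁)
open Summit.QuantumFields.BalabanUV.Beta.GAN24.HarmonicPeriodicTwoForm (sum_box_shift eq_zero_of_periodic_of_box curv_add_eq_const
  card_mul_const_eq_sum_box)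

variable {d N : ℕ} [NeZero N]

/-! ## §1 `dz` and `codiff₁` are adjoint on cell sums; the gauge energy identity -/

/-- [folklore] **SUMMATION BY PARTS ON ONE CELL, DEGREE 0∕1**: for block-periodic `g` (0-form) and `A` (1-form),
`Σ_{r ∈ box} Σ_κ (dz g) κ x · A κ x = Σ_{r ∈ box} g x · (codiff₁ A) x` (`x = toSite r`). -/
theorem sum_box_dz_mul {g : Form0 d ℝ} {A : Form1 d ℝ} (hg : IsPeriodic N g) (hA : ∀ κ, IsPeriodic N (A κ)) :
    ∑ r ∈ box d N, ∑ κ, dz g κ (toSite r) * A κ (toSite r) = ∑ r ∈ box d N, g (toSite r) * codiff₁ A (toSite r) := by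
  simp only [dz, codiff₁, Finset.mul_sum]
  rw [Finset.sum_comm, Finset.sum_comm (s := box d N)]
  refine Finset.sum_congr rfl fun κ _ => ?_
  have e := sum_box_shift (N := N) (f := fun x => g x * A κ (x - unitVec κ))
    (fun x a => by
      simp only
      rw [show x + (N : ℤ) • a - unitVec κ = (x - unitVec κ) + (N : ℤ) • a by abel, hg, hA]) (unitVec κ)
  simp only [add_sub_cancel_right] at e
  simp only [sub_mul, mul_sub, Finset.sum_sub_distrib, e]

/-- [folklore] **THE GAUGE ENERGY IDENTITY**: `Σ_{r ∈ box} Σ_κ ((dz g) κ x)² = Σ_{r ∈ box} g x · codiff₁ (dz g) x` for block-periodic `g`. -/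
theorem sum_box_sq_dz_eq_mul_codiff {g : Form0 d ℝ} (hg : IsPeriodic N g) :
    ∑ r ∈ box d N, ∑ κ, dz g κ (toSite r) ^ 2 = ∑ r ∈ box d N, g (toSite r) * codiff₁ (dz g) (toSite r) := by
  have hdz : ∀ κ, IsPeriodic N (dz g κ) := fun κ x a => by
    simp only [dz]
    rw [add_right_comm, hg, hg]
  rw [← sum_box_dz_mul (N := N) hg hdz]
  refine Finset.sum_congr rfl fun r _ => Finset.sum_congr rfl fun κ _ => ?_
  ring

/-- [folklore] **`codiff₁ (dz g) = 0` FOR BLOCK-PERIODIC `g` FORCES `dz g = 0`** (every term of the gauge energy is a square; a periodic gradient vanishing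
on one cell vanishes) — the step «the gauge term of the Euler–Lagrange row drops» of the resolvent flux identity. -/
theorem dz_eq_zero_of_periodic_codiff_dz {g : Form0 d ℝ} (hg : IsPeriodic N g) (h : ∀ x, codiff₁ (dz g) x = 0) : dz g = 0 := by
  have hsum : ∑ r ∈ box d N, ∑ κ, dz g κ (toSite r) ^ 2 = 0 := by
    rw [sum_box_sq_dz_eq_mul_codiff (N := N) hg]
    exact Finset.sum_eq_zero fun r _ => by rw [h, mul_zero]
  have hterm : ∀ r ∈ box d N, ∀ κ, dz g κ (toSite r) = 0 := fun r hr κ =>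
    (pow_eq_zero_iff two_ne_zero).1 ((Finset.sum_eq_zero_iff_of_nonneg fun κ' _ => sq_nonneg _).1
      ((Finset.sum_eq_zero_iff_of_nonneg fun r' _ => Finset.sum_nonneg fun κ' _ => sq_nonneg _).1 hsum r hr) κ (Finset.mem_univ κ))
  funext κ x
  have hper : IsPeriodic N (dz g κ) := fun y a => by
    simp only [dz]
    rw [add_right_comm, hg, hg]
  exact eq_zero_of_periodic_of_box (N := N) hper (fun r hr => hterm r hr κ) x

/-! ## §2 `curv` and `curvAdj` are adjoint on cell sums -/

/-- [folklore] **SUMMATION BY PARTS ON ONE CELL, DEGREE 1∕2**: for block-periodic `F` (2-form, all ordered pairs) and `A` (1-form),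
`Σ_{r ∈ box} Σ_μ (curvAdj F) μ x · A μ x = Σ_{r ∈ box} Σ_κ Σ_l F κ l x · (curv A) κ l x` (`x = toSite r`) — `curvAdj` IS the formal adjoint of `curv` for
the all-ordered-pairs pairing, on the torus (the difference of the two integrands is a sum of shift differences). -/
theorem sum_box_curvAdj_mul {F : Form2 d ℝ} {A : Form1 d ℝ} (hF : ∀ κ l, IsPeriodic N (F κ l)) (hA : ∀ κ, IsPeriodic N (A κ)) :
    ∑ r ∈ box d N, ∑ μ, curvAdj F μ (toSite r) * A μ (toSite r) =
      ∑ r ∈ box d N, ∑ κ, ∑ l, F κ l (toSite r) * curv A κ l (toSite r) := by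
  have s1 : ∀ κ l : Fin d, ∑ r ∈ box d N, F κ l (toSite r - unitVec l) * A κ (toSite r) =
      ∑ r ∈ box d N, F κ l (toSite r) * A κ (toSite r + unitVec l) := by
    intro κ l
    have e := sum_box_shift (N := N) (f := fun x => F κ l (x - unitVec l) * A κ x)
      (fun x a => by
        simp only
        rw [show x + (N : ℤ) • a - unitVec l = (x - unitVec l) + (N : ℤ) • a by abel, hF, hA]) (unitVec l)
    simp only [add_sub_cancel_right] at e
    exact e.symm
  have s2 : ∀ κ l : Fin d, ∑ r ∈ box d N, F κ l (toSite r - unitVec κ) * A l (toSite r) =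
      ∑ r ∈ box d N, F κ l (toSite r) * A l (toSite r + unitVec κ) := by
    intro κ l
    have e := sum_box_shift (N := N) (f := fun x => F κ l (x - unitVec κ) * A l x)
      (fun x a => by
        simp only
        rw [show x + (N : ℤ) • a - unitVec κ = (x - unitVec κ) + (N : ℤ) • a by abel, hF, hA]) (unitVec κ)
    simp only [add_sub_cancel_right] at e
    exact e.symm
  -- pointwise: the difference of the two integrands, pair by pair
  have hpt : ∀ x : AffineAveraging.Site d, ∑ μ, curvAdj F μ x * A μ x - ∑ κ, ∑ l, F κ l x * curv A κ l x =
      ∑ κ, ∑ l, ((F κ l x * A κ (x + unitVec l) - F κ l (x - unitVec l) * A κ x) -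
        (F κ l x * A l (x + unitVec κ) - F κ l (x - unitVec κ) * A l x)) := by
    intro x
    have e1 : ∑ μ, curvAdj F μ x * A μ x = ∑ κ, ∑ l, (F κ l x - F κ l (x - unitVec l)) * A κ x
        + ∑ κ, ∑ l, (F κ l (x - unitVec κ) - F κ l x) * A l x := by
      simp only [curvAdj, add_mul, Finset.sum_mul, Finset.sum_add_distrib]
      congr 1
      exact Finset.sum_comm
    have e2 : ∑ κ, ∑ l, F κ l x * curv A κ l x =
        ∑ κ, ∑ l, (F κ l x * A κ x + F κ l x * A l (x + unitVec κ) - F κ l x * A κ (x + unitVec l) - F κ l x * A l x) := by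
      simp only [curv]
      exact Finset.sum_congr rfl fun κ _ => Finset.sum_congr rfl fun l _ => by ring
    rw [e1, e2, ← Finset.sum_add_distrib, ← Finset.sum_sub_distrib]
    refine Finset.sum_congr rfl fun κ _ => ?_
    rw [← Finset.sum_add_distrib, ← Finset.sum_sub_distrib]
    exact Finset.sum_congr rfl fun l _ => by ring
  rw [← sub_eq_zero, ← Finset.sum_sub_distrib, Finset.sum_congr rfl fun r _ => hpt (toSite r), Finset.sum_comm]
  refine Finset.sum_eq_zero fun κ _ => ?_
  rw [Finset.sum_comm]
  refine Finset.sum_eq_zero fun l _ => ?_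
  rw [Finset.sum_sub_distrib, Finset.sum_sub_distrib, Finset.sum_sub_distrib, s1 κ l, s2 κ l]
  ring

/-! ## §3 The edge current is minus one half of a codifferential -/

/-- [folklore] **THE EDGE CURRENT OF `WilsonEdgeCurrent` IS `−½·curvAdj (p ⊗ q)`**: with the antisymmetric plaquette-column 2-form
`F κ l x := [κ = γ][l = α]·p(x_γ)·q(x_α) − [κ = α][l = γ]·p(x_γ)·q(x_α)` (`γ ≠ α`), for every component `b` and site `z`,
`[b = γ]·p(z_γ)·(q(z_α − 1) − q(z_α)) + [b = α]·q(z_α)·(p(z_γ) − p(z_γ − 1)) = −½·(curvAdj F) b z`. -/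
theorem edgeCurrent_eq_neg_half_curvAdj {γ α : Fin d} (hγα : γ ≠ α) (p q : ℤ → ℝ) (b : Fin d) (z : AffineAveraging.Site d) :
    (if b = γ then p (z γ) * (q (z α - 1) - q (z α)) else 0) + (if b = α then q (z α) * (p (z γ) - p (z γ - 1)) else 0) =
      -(1 / 2 : ℝ) * curvAdj (fun κ l (x : AffineAveraging.Site d) =>
        (if κ = γ ∧ l = α then p (x γ) * q (x α) else 0) - (if κ = α ∧ l = γ then p (x γ) * q (x α) else 0)) b z := by
  have hzγ : ∀ l : Fin d, (z - unitVec l) γ = z γ - if γ = l then 1 else 0 := fun l => by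
    simp [unitVec, Pi.single_apply]
  have hzα : ∀ l : Fin d, (z - unitVec l) α = z α - if α = l then 1 else 0 := fun l => by
    simp [unitVec, Pi.single_apply]
  simp only [curvAdj, hzγ, hzα]
  by_cases hbγ : b = γ
  · subst hbγ
    rw [Finset.sum_eq_single_of_mem α (Finset.mem_univ α) (fun l _ hl => by simp [hl, hγα]),
      Finset.sum_eq_single_of_mem α (Finset.mem_univ α) (fun l _ hl => by simp [hl, hγα])]
    simp [hγα, Ne.symm hγα]
    ring
  · by_cases hbα : b = α
    · subst hbα
      rw [Finset.sum_eq_single_of_mem γ (Finset.mem_univ γ) (fun l _ hl => by simp [hl, hbγ]),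
        Finset.sum_eq_single_of_mem γ (Finset.mem_univ γ) (fun l _ hl => by simp [hl, hbγ])]
      simp [hbγ, Ne.symm hbγ]
      ring
    · simp [hbγ, hbα]

/-! ## §4 The flux identity for a periodic Euler–Lagrange solution with vanishing averaging multiplier -/

omit [NeZero N] in
/-- [folklore] `curvAdj` is linear (the instance used below, pointwise). -/
theorem curvAdj_add_mul_apply (G F : Form2 d ℝ) (c : ℝ) (μ : Fin d) (y : AffineAveraging.Site d) :
    curvAdj (fun κ l x => G κ l x + c * F κ l x) μ y = curvAdj G μ y + c * curvAdj F μ y := by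
  simp only [curvAdj, Finset.mul_sum, Finset.sum_add_distrib, mul_add, mul_sub, Finset.sum_sub_distrib]
  ring

/-- [folklore] **THE GAUGE TERM DROPS**: if a 1-form `A` solves the Euler–Lagrange row `curvAdj (curv A) = dz g + J` with a block-periodic gauge
potential `g` and a DIVERGENCE-FREE force (`codiff₁ J = 0`), then `dz g = 0` and `curvAdj (curv A) = J` (apply `codiff₁`: `codiff₁ ∘ curvAdj = 0`
(`ResolventComposition.codiff₁_curvAdj`) leaves `codiff₁ (dz g) = 0`, and the gauge energy identity of §1 forces `dz g = 0`). -/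
theorem curvAdj_curv_eq_of_el {A J : Form1 d ℝ} {g : Form0 d ℝ} (hg : IsPeriodic N g)
    (hel : ∀ κ x, curvAdj (curv A) κ x = dz g κ x + J κ x) (hJ : ∀ x, codiff₁ J x = 0) : curvAdj (curv A) = J := by
  have e : ∀ x, codiff₁ (dz g) x = 0 := by
    intro x
    have h0 := congrFun (ResolventComposition.codiff₁_curvAdj (curv A)) x
    have hJ0 := hJ x
    simp only [codiff₁, Pi.zero_apply] at h0 hJ0 ⊢
    simp only [hel] at h0
    calc ∑ κ, (dz g κ (x - unitVec κ) - dz g κ x)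
        = ∑ κ, ((dz g κ (x - unitVec κ) + J κ (x - unitVec κ)) - (dz g κ x + J κ x)) - ∑ κ, (J κ (x - unitVec κ) - J κ x) := by
          rw [← Finset.sum_sub_distrib]
          exact Finset.sum_congr rfl fun κ _ => by ring
      _ = 0 := by rw [h0, hJ0, sub_zero]
  have hdz : dz g = 0 := dz_eq_zero_of_periodic_codiff_dz (N := N) hg e
  funext κ x
  rw [hel, hdz, Pi.zero_apply, Pi.zero_apply, zero_add]

/-- [folklore] **THE RESOLVENT FLUX IDENTITY, PERIODIC FORM** (note §8 (d′), steps (ii)–(v); generic `d`, every period `N ≥ 1`): let `A` be a block-periodic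
1-form solving `curvAdj (curv A) = dz g − ½·curvAdj F` with a block-periodic gauge potential `g` (the `U = 1` KKT Euler–Lagrange row with force the current
`J = −½·curvAdj F` and VANISHING averaging multiplier), `F` a block-periodic, antisymmetric, closed 2-form.  Then `curv A + ½F` is the constant `½·avg F`:
`|box|·(curv A κ l x + ½·F κ l x) = ½·Σ_{r ∈ box} F κ l (toSite r)` for every `κ l x`.  (For the plaquette-column `F = p ⊗ q` of the edge current this is
`curv (K·J) = ½(avg F − F)`: in-plane flux `½(L⁻²·|column| − 𝟙_column)`, zero across planes.) -/
theorem card_mul_curv_add_half_eq {A : Form1 d ℝ} {F : Form2 d ℝ} {g : Form0 d ℝ}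
    (hA : ∀ κ, IsPeriodic N (A κ)) (hF : ∀ κ l, IsPeriodic N (F κ l)) (hFa : ∀ κ l x, F κ l x = -F l κ x)
    (hFcl : ∀ (κ l m : Fin d) (x : AffineAveraging.Site d),
      (F l m (x + unitVec κ) - F l m x) + (F m κ (x + unitVec l) - F m κ x) + (F κ l (x + unitVec m) - F κ l x) = 0)
    (hg : IsPeriodic N g)
    (hel : ∀ κ x, curvAdj (curv A) κ x = dz g κ x + -(1 / 2 : ℝ) * curvAdj F κ x)
    (κ l : Fin d) (x : AffineAveraging.Site d) :
    ((box d N).card : ℝ) * (curv A κ l x + (1 / 2 : ℝ) * F κ l x) = (1 / 2 : ℝ) * ∑ r ∈ box d N, F κ l (toSite r) := by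
  -- the current is divergence-free, so the gauge term drops
  have hJ : ∀ y, codiff₁ (fun κ x => -(1 / 2 : ℝ) * curvAdj F κ x) y = 0 := by
    intro y
    have h := congrFun (ResolventComposition.codiff₁_curvAdj F) y
    simp only [codiff₁, Pi.zero_apply] at h ⊢
    calc ∑ κ, (-(1 / 2 : ℝ) * curvAdj F κ (y - unitVec κ) - -(1 / 2 : ℝ) * curvAdj F κ y)
        = -(1 / 2 : ℝ) * ∑ κ, (curvAdj F κ (y - unitVec κ) - curvAdj F κ y) := by
          rw [Finset.mul_sum]
          exact Finset.sum_congr rfl fun κ _ => by ring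
      _ = 0 := by rw [h, mul_zero]
  have hel' := curvAdj_curv_eq_of_el (N := N) hg hel hJ
  -- hence `curv A + ½F` is co-closed
  have hco : curvAdj (fun κ l x => curv A κ l x + (1 / 2 : ℝ) * F κ l x) = 0 := by
    funext μ y
    rw [curvAdj_add_mul_apply, hel']
    show -(1 / 2 : ℝ) * curvAdj F μ y + 1 / 2 * curvAdj F μ y = (0 : Form1 d ℝ) μ y
    simp only [Pi.zero_apply]
    ring
  have hconst := curv_add_eq_const (N := N) hA hF hFa hFcl (1 / 2 : ℝ) hco κ l x
  have havg := card_mul_const_eq_sum_box (N := N) hA hF hFa hFcl (1 / 2 : ℝ) hco κ l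
  rw [hconst, havg]

end Summit.QuantumFields.BalabanUV.Beta.GAN24.PeriodicCellPairing

end
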